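import Summits.Ventures.PackingBounds.ThreePointCert.CheckSym2
import Summits.Ventures.PackingBounds.ThreePointCert.CheckKron
import Summits.Ventures.PackingBounds.ThreePointCert.CheckFastFZ
import Summits.Ventures.PackingBounds.ThreePointCert.S4T13ExpandR0p1
import Summits.Ventures.PackingBounds.ThreePointCert.S4T13ExpandR0p2
import Summits.Ventures.PackingBounds.ThreePointCert.S4T13ExpandR1p1
import Summits.Ventures.PackingBounds.ThreePointCert.S4T13ExpandR2p1
import Summits.Ventures.PackingBounds.ThreePointCert.S4T13ExpandR3p1
import Summits.Ventures.PackingBounds.ThreePointCert.S4T13ExpandR4p1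
import Summits.Ventures.PackingBounds.ThreePointCert.S4T13ExpandQG1
import Summits.Ventures.PackingBounds.ThreePointCert.S4T13ExpandQG2
import Summits.Ventures.PackingBounds.ThreePointCert.S4T13ExpandQG3

/-!
# θ_13(S^4) ≤ 81.2804°: A(5, 379/2500) ≤ 12: the kernel-checked theorem

Framing: lottery ticket; floor = certified bounds/negative ranges. Venture `PackingBounds` (cell
`pub-packcert`), three-point SDP family. Integer data of a feasible point of the Bachoc–Vallentin
semidefinite program (n = 5, s = 379/2500, degree d = 10, Bachoc–Vallentin
multiplier set = cell mode sym2), derived by `cert2lean_s2.py` (sdp gen 5 fork of cert2lean_lp.py) from the exact rational certificate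
`sdp-n5-d10-s379-2500-sym2f-lpclient-v1.json` of the cell (exact verifier #1 + verifier #2 of the other seat), in the units of the kernel
checker `ThreePointCert.Check` + `CheckSym2` (soundness `card_le_of_cert3S2`); Gram factors offset-encoded for the
Kronecker-packed chunk validation `ThreePointCert.CheckKron` (emitter `emitleanS2.py` = lp gen 3 emitleanK.py). Generated file: plain
lists of integers / monomials.
-/

namespace Summit.Ventures.PackingBounds.ThreePointCert.S4T13

open Literature.Geometry.DiscreteGeometry Literature.Geometry.DiscreteGeometry.PolyCert PolyCert.SPoly

set_option maxRecDepth 100000 in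
/-- All expansion data are valid (assembled from the kernel validations). -/
theorem polys_ok : PolysOK3 S4T13.cert S4T13.polys S4T13.gR0 S4T13.gR1 S4T13.gR2 S4T13.gR3 S4T13.gR4 S4T13.gQ0 S4T13.gQ1 where
  hF := fexpValidG_of_fchunkVal cert eFP _ (by rfl) (fchunkVal_append _ _ _ _ _ _ (fchunkVal_append _ _ _ _ _ _ (fchunkVal_append _ _ _ _ _ _ (fchunkVal_append _ _ _ _ _ _ (fchunkVal_append _ _ _ _ _ _ (fchunkVal_append _ _ _ _ _ _ (fchunkVal_append _ _ _ _ _ _ (fchunkVal_of_okFZ _ _ _ _ okF_1) (fchunkVal_of_okFZ _ _ _ _ okF_2)) (fchunkVal_of_okFZ _ _ _ _ okF_3)) (fchunkVal_of_okFZ _ _ _ _ okF_4)) (fchunkVal_of_okFZ _ _ _ _ okF_5)) (fchunkVal_of_okFZ _ _ _ _ okF_6)) (fchunkVal_of_okFZ _ _ _ _ okF_7)) (fchunkVal_of_okFZ _ _ _ _ okF_8))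
  h0 := by
    have c := chunkVal_of_okK _ _ _ _ _ okR0_1
    have c := chunkVal_trans _ _ _ _ _ _ _ c (chunkVal_of_okK _ _ _ _ _ okR0_2)
    have c := chunkVal_trans _ _ _ _ _ _ _ c (chunkVal_of_okK _ _ _ _ _ okR0_3)
    exact c
  h1 := rvalid_of_singleK gR1K eR1 okR1_1
  h2 := rvalid_of_singleK gR2K eR2 okR2_1
  h3 := rvalid_of_singleK gR3K eR3 okR3_1
  h4 := rvalid_of_singleK gR4K eR4 okR4_1
  hq0 := rvalid_of_singleK gQ0K eQ0 okQ0_1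
  hq1 := rvalid_of_singleK gQ1K eQ1 okQ1_1

set_option maxHeartbeats 0 in
/-- The side conditions hold. -/
theorem cert_side : checkSide3 S4T13.cert = true := by decide +kernel

set_option maxHeartbeats 0 in
/-- The numerical bound is `< N + 1` (and `≥ 0`). -/
theorem cert_bound : checkBound3 S4T13.cert S4T13.polys = true := by decide +kernel

set_option maxRecDepth 100000 in
set_option maxHeartbeats 0 in
/-- The certificate passes the check of constraint `(i')`. -/
theorem cert_I : checkI3 S4T13.cert S4T13.polys = true := by decide +kernel

set_option maxRecDepth 100000 in
set_option maxHeartbeats 0 in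
/-- The certificate passes the check of constraint `(ii')` (Bachoc–Vallentin multiplier set). -/
theorem cert_II : checkII3S2 S4T13.cert S4T13.polys = true := by decide +kernel

/-- **θ_13(S^4) ≤ 81.2804°: A(5, 379/2500) ≤ 12**: every finite set of unit vectors of `ℝ^5` with pairwise inner products
`≤ 379 / 2500` has at most `12` elements — the Bachoc–Vallentin three-point (semidefinite
programming) bound with their original multiplier set, degree 10, from an exact certificate (bound value 12.962106), kernel-checked.
[cite: BachocVallentin2007, Theorem 4.2] -/
theorem tammesS4_13_card_le_12_sdp (C : Finset (EuclideanSpace ℝ (Fin 5)))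
    (h1 : ∀ x ∈ C, ‖x‖ = 1) (h2 : ∀ x ∈ C, ∀ y ∈ C, x ≠ y → inner ℝ x y ≤ 379 / 2500) :
    C.card ≤ 12 :=
  card_le_of_cert3S2 cert polys polys_ok cert_I cert_II cert_side cert_bound C h1
    (fun x hx y hy hxy => by
      have h := h2 x hx y hy hxy
      have e : ((cert.p : ℤ) : ℝ) / (cert.q : ℕ) = 379 / 2500 := by norm_num [cert]
      rw [e]; exact h)

end Summit.Ventures.PackingBounds.ThreePointCert.S4T13
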